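import Literature.NumberTheory.QuadraticFields.IwaniecOrderYield
import Literature.NumberTheory.EllipticCurves.Curve5077aRootNumber
import Literature.NumberTheory.EllipticCurves.BSDRootNumberModularityOnlyProofs
import HarnessLib

/-!
# The yield schema: the `r₀ = 3` instance on 5077a, and the sign-free square-level shape

Topic `NumberTheory/QuadraticFields` (namespace `Literature.NumberTheory.QuadraticFields`).
Two corollaries of the exponent law `le_classNumber_logPow_of_le_analyticRank`
(`IwaniecOrderYield.lean`). First, its instance at the one provable order the Goldfeld census
holds, `r₀ = 3` on `E = 5077a`
(`y² + y = x³ − 7x + 6`, Buhler–Gross–Zagier 1985): the tree proves `3 ≤ ord_{s=1} L(E, s)`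
from the Modularity Theorem and Gross–Zagier–Kolyvagin (`Curve5077a.three_le_analyticRank_E`),
`w(E) = −1` (`Curve5077a.rootNumber_E`) and `N_E = 5077` (`Curve5077a.conductorNorm_E`). Hence,
modulo the THREE named facts {Iwaniec 2006 Thm 4.1, modularity, GZK}:

* `le_classNumber_log_of_curve5077a` — there is `c > 0` such that for every imaginary quadratic
  `K` with `(5077, d_K) = 1`: if `w(E^{(d_K)}) = −1` then `c · θ(d) · log d ≤ h(−d)` (exponent
  `r₀ + δ − 3 = 1`), and if `w(E^{(d_K)}) = +1` then `c · θ(d) ≤ h(−d)` (exponent `0`).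

This is the SHAPE of the theorem of record (Oesterlé 1985, Thm 1 with `C = 55` on
`(d, 5077) = 1`; Gross–Zagier 1986 (8.2)) reached through a second printed amplification
statement: the tree's `oesterle_theoreme1_of_coprime_5077` (`Oesterle5077Family.lean`) derives
`ϑ(d) log d ≤ C h(−d)` on the same domain modulo FOUR named facts {Oesterlé Thm 2, Oesterlé
Prop 2, modularity, GZK}, covering the complementary class by the elementary split-prime bound
(Oesterlé §1.4 a), `OesterleSplitPrimeBound.lean`). Here the classes are Iwaniec's own
(`w = χ_D(−N)`, (4.10)): `w(E^{(d)}) = −1 ⇔ χ_d(5077) = −1 ⇔ 5077` inert in `K` (Oesterlé's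
`𝒦⁻_{5077}`), and on the split class Thm 4.1 gives only the exponent `0`.

Second, `le_classNumber_logSq_of_four_le_analyticRank_of_isSquare_conductorNorm'` removes the sign
hypothesis from the square-level target shape of `IwaniecOrderYield.lean`: at square level
`4 ≤ ord_{s=1} L(E, s)` alone gives `c·θ(d)(log d)² ≤ h(−d)` for all coprime `d` (if
`w(E) = −1` the order is odd, hence `≥ 5`, and `le_classNumber_logSq_of_five_le_analyticRank`
applies; remark R2 of the cell's second reader). Third,
`le_classNumber_logSq_of_isSquare_conductorNorm_of_analyticRank_ne_two` states the same shape with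
the census WALL as its only non-certifiable hypothesis: square conductor, `w = +1`, two
independent points (`rank ≥ 2 ⇒ r_an ≥ 2` by Gross–Zagier–Kolyvagin) and `r_an ≠ 2`. No
definition, no new named fact (D-0026).

## References

* [IwaniecConversations2006] H. Iwaniec, *Conversations on the exceptional character*, LNM 1891
  (2006), §4, Thm 4.1 and (4.10).
* [Oesterle1985] J. Oesterlé, Sém. Bourbaki 631, Astérisque 121–122 (1985), Thm 1, §5.1 (p. 321:
  «C = 55 à condition de se restreindre aux discriminants d premiers à 5077»).
* [BuhlerGrossZagier1985] J. P. Buhler, B. H. Gross, D. B. Zagier, Math. Comp. 44 (1985) 473–481.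
* [GrossZagier1986] B. H. Gross, D. B. Zagier, Invent. Math. 84 (1986), I (8.2).
* [Goldfeld1977] D. Goldfeld, Astérisque 41–42 (1977) 219–227, Thm 3 (p. 223) and Example 2
  (p. 222): the square-conductor rank-4 antecedent of the `(log d)²` shape.
* [Darmon2004] H. Darmon, CBMS 101 (2004), Thm. 3.22 (Gross–Zagier–Kolyvagin).
-/

noncomputable section

open WeierstrassCurve NumberField Literature.NumberTheory.EllipticCurves
  Literature.NumberTheory.EllipticCurves.ModularForms Literature.NumberTheory.EllipticCurves.Curve5077a

namespace Literature.NumberTheory.QuadraticFields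

/-- **Iwaniec's exponent law on 5077a (`r₀ = 3`, `w = −1`).** Assume Iwaniec 2006 Thm 4.1
(`Iwaniec2006_theorem_4_1_weightTwo`), the Modularity Theorem (`exists_isNewformOf`) and
Gross–Zagier–Kolyvagin in the printed form `r_an ≤ 1 ⇒ rank = r_an`
(`rank_eq_analyticRank_of_analyticRank_le_one`). Then there is `c > 0` such that for every
imaginary quadratic field `K` with `(5077, d_K) = 1`, writing `d = |d_K|`, `h = h_K`,
`θ = iwaniecTheta d`: `w(E^{(d_K)}) = −1 ⇒ c·θ·log d ≤ h` and `w(E^{(d_K)}) = +1 ⇒ c·θ ≤ h`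
(`E = 5077a`; inputs `three_le_analyticRank_E`, `rootNumber_E`, `conductorNorm_E`). The first
clause is the shape of Oesterlé 1985 Thm 1 / Gross–Zagier (8.2) on Oesterlé's class `𝒦⁻_{5077}`
(«h(D) > (1/55) log |D|» for prime |D|), modulo three named facts instead of the four of
`oesterle_theoreme1_of_coprime_5077`. [cite: IwaniecConversations2006, Thm 4.1]
[cite: Oesterle1985, Thm 1 and §5.1 (p. 321)] [cite: GrossZagier1986, I (8.2)] -/
theorem le_classNumber_log_of_curve5077a (hIw : Iwaniec2006_theorem_4_1_weightTwo)
    (hmod : exists_isNewformOf) (hGZK : rank_eq_analyticRank_of_analyticRank_le_one) :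
    ∃ c : ℝ, 0 < c ∧
      ∀ (K : Type) [Field K] [NumberField K],
        Module.finrank ℚ K = 2 → NumberField.discr K < 0 →
        Nat.Coprime 5077 (NumberField.discr K).natAbs →
        ((E.quadraticTwist (NumberField.discr K : ℚ)).rootNumber = -1 →
            c * iwaniecTheta (NumberField.discr K).natAbs *
                Real.log ((NumberField.discr K).natAbs : ℝ)
              ≤ (NumberField.classNumber K : ℝ)) ∧
        ((E.quadraticTwist (NumberField.discr K : ℚ)).rootNumber = 1 →
            c * iwaniecTheta (NumberField.discr K).natAbs ≤ (NumberField.classNumber K : ℝ)) := by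
  obtain ⟨c, hc, h⟩ := le_classNumber_logPow_of_le_analyticRank E hIw (r₀ := 3) le_rfl
    (three_le_analyticRank_E hmod hGZK) (by rw [rootNumber_E hmod]; norm_num)
  refine ⟨c, hc, fun K _ _ h2 hneg hcop ↦ ?_⟩
  have hcop' : (E.conductorNorm ℤ).Coprime (NumberField.discr K).natAbs := by
    rw [conductorNorm_E]; exact hcop
  obtain ⟨h1, h0⟩ := h K h2 hneg hcop'
  exact ⟨fun hw ↦ by simpa using h1 hw, fun hw ↦ by simpa using h0 hw⟩

/-- **Square level, `ord ≥ 4` of either sign ⇒ `(log d)²` for all coprime `d`.** Assume Iwaniec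
2006 Thm 4.1 and the Modularity Theorem. If `E / ℚ` is elliptic with square conductor and
`ord_{s=1} L(E, s) ≥ 4`, then `c·θ(d)·(log d)² ≤ h(−d)` for every imaginary quadratic `d` prime to
`N_E`: for `w(E) = +1` this is `le_classNumber_logSq_of_four_le_analyticRank_of_isSquare_conductorNorm`
(every coprime twist is odd); for `w(E) = −1` the order is odd
(`odd_analyticRank_of_rootNumber_eq_neg_one`, unconditional), hence `≥ 5`, and
`le_classNumber_logSq_of_five_le_analyticRank` applies at any level. The sign hypothesis of the
square-level target shape is thus removable (second-reader remark R2, rh-explicit Goldfeld cell).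
Printed antecedent: this is the SHAPE of Goldfeld 1977, Theorem 3 (Astérisque 41–42, p. 223:
for Wiman's rank-4 curve `E₂` of square conductor `2⁶m²`, «`L″_{E₂}(1) = 0`» ⇒
`H > c(ε)(log d)^{2−ε}` for `(d, 2m) = 1`; the printed `m = 3·7·11·17·41` carries a spurious
factor `11` — Wiman's curve is the congruent-number curve `n = 29274 = 2·3·7·17·41`, `w = +1`,
rank `4`, cell ruling G-8), with Iwaniec's `θ(d)(log d)²` for `(log d)^{2−ε}` and the hypothesis
`4 ≤ analyticRank` for «`L″(1) = 0`» (equivalent there: `w = +1`, `L(E₂,1) = 0`).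
[cite: IwaniecConversations2006, Thm 4.1] [cite: Goldfeld1977, Thm 3 (p. 223)] -/
theorem le_classNumber_logSq_of_four_le_analyticRank_of_isSquare_conductorNorm'
    (hIw : Iwaniec2006_theorem_4_1_weightTwo) (hmod : exists_isNewformOf)
    (W : WeierstrassCurve ℚ) [W.IsElliptic] (hsqN : IsSquare (W.conductorNorm ℤ))
    (h4 : 4 ≤ W.analyticRank) :
    ∃ c : ℝ, 0 < c ∧
      ∀ (K : Type) [Field K] [NumberField K],
        Module.finrank ℚ K = 2 → NumberField.discr K < 0 →
        (W.conductorNorm ℤ).Coprime (NumberField.discr K).natAbs →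
        c * iwaniecTheta (NumberField.discr K).natAbs *
            Real.log ((NumberField.discr K).natAbs : ℝ) ^ 2
          ≤ (NumberField.classNumber K : ℝ) := by
  rcases W.rootNumber_eq_one_or with hw | hw
  · exact le_classNumber_logSq_of_four_le_analyticRank_of_isSquare_conductorNorm W hIw hmod hsqN
      hw h4
  · have hodd := odd_analyticRank_of_rootNumber_eq_neg_one hw
    have h5 : 5 ≤ W.analyticRank := by
      obtain ⟨k, hk⟩ := hodd
      omega
    exact le_classNumber_logSq_of_five_le_analyticRank W hIw hw h5

/-- **The square-level `(log d)²` shape with the wall as its only non-certifiable hypothesis.**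
Assume Iwaniec 2006 Thm 4.1, the Modularity Theorem and Gross–Zagier–Kolyvagin in the printed
form `r_an ≤ 1 ⇒ rank = r_an` (`rank_eq_analyticRank_of_analyticRank_le_one`). Let `E / ℚ` be
elliptic with square conductor, `w(E) = +1` and TWO independent rational points
(`2 ≤ mordellWeilRank`, certifiable by exhibiting points). If `ord_{s=1} L(E, s) ≠ 2`, then
`c·θ(d)·(log d)² ≤ h(−d)` for every imaginary quadratic `d` prime to `N_E`. Indeed
`rank ≥ 2 ⇒ r_an ≥ 2` (GZK, `two_le_analyticRank_of_two_le_mordellWeilRank`), `w = +1 ⇒ r_an`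
even (modularity), so `r_an ≠ 2 ⇒ r_an ≥ 4` and
`le_classNumber_logSq_of_four_le_analyticRank_of_isSquare_conductorNorm` applies. This is the
census's statement of the wall (CENSUS-2 §5.5): for such a curve — e.g. Wiman's / Goldfeld's
square-conductor rank-4 curve `n = 29274` (Goldfeld 1977 Thm 3, emended) — the ONLY input that is
neither a printed theorem nor a finite certificate is `r_an ≠ 2`, the analytic-rank-2 case of
`rank ≤ analytic rank`; the exhibited rank `4` serves only as the reason to expect `r_an = 4`.
[cite: Goldfeld1977, Thm 3 (p. 223)] [cite: IwaniecConversations2006, Thm 4.1]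
[cite: Darmon2004, Thm. 3.22] -/
theorem le_classNumber_logSq_of_isSquare_conductorNorm_of_analyticRank_ne_two
    (hIw : Iwaniec2006_theorem_4_1_weightTwo) (hmod : exists_isNewformOf)
    (hGZK : rank_eq_analyticRank_of_analyticRank_le_one)
    (W : WeierstrassCurve ℚ) [W.IsElliptic] (hsqN : IsSquare (W.conductorNorm ℤ))
    (hw : W.rootNumber = 1) (hrank : 2 ≤ W.mordellWeilRank) (hne : W.analyticRank ≠ 2) :
    ∃ c : ℝ, 0 < c ∧
      ∀ (K : Type) [Field K] [NumberField K],
        Module.finrank ℚ K = 2 → NumberField.discr K < 0 →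
        (W.conductorNorm ℤ).Coprime (NumberField.discr K).natAbs →
        c * iwaniecTheta (NumberField.discr K).natAbs *
            Real.log ((NumberField.discr K).natAbs : ℝ) ^ 2
          ≤ (NumberField.classNumber K : ℝ) := by
  have h2 := two_le_analyticRank_of_two_le_mordellWeilRank W hGZK hrank
  have hpar : Even W.analyticRank ↔ W.rootNumber = 1 :=
    even_analyticRank_iff_rootNumber_eq_one_of_exists_isNewformOf W hmod
  have h4 : 4 ≤ W.analyticRank := by
    obtain ⟨k, hk⟩ := hpar.mpr hw
    omega
  exact le_classNumber_logSq_of_four_le_analyticRank_of_isSquare_conductorNorm W hIw hmod hsqN hw h4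

end Literature.NumberTheory.QuadraticFields

end
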